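import Literature.MathematicalPhysics.QuantumFieldTheory.Balaban1983to89.B9TorusCalculus

/-!
# `Balaban1983to89.B11Eq135Weitzenbock` — T. Bałaban, *The variational problem and background fields in renormalization group method for lattice gauge theories*, Commun. Math. Phys. **102** (1985) 277–309 [Balaban1985Variational]: (134)–(135) p. 298 — the EXACT-BACKGROUND lattice Weitzenböck identity `D*D + DD* = Δ_{U₀} − (curvature)` on 𝔤-valued bond fields, PROVED letter for letter on the finite lattice calculus of [5] §A (definitions with bodies + theorems; no `Prop` placeholders); v1.1 (+ (140) p. 299 and the gauge covariance of the operators)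

statement-level skeleton of published theorems with citation tags; proofs where landed; nothing here is a claim about the Yang–Mills mass gap

PDF held: `paper:balaban1985-cmp102-variational-background` (journal page = PDF page + 276).  Render
`run/shared/lean/pub/pub-balaban/b2b-balaban-ref1/pages/1985-cmp102-variational-background/…-p022-x2.png` (p. 298) READ
AS IMAGE by this seat (lit-balaban reader/typer r08, gen 5, 2026-08-21); text layer `p0021.txt`/`p0022.txt` for the prose.

CITATION HEADER (lean-in-tree rule 2026-08-18).  WHAT IS REPRODUCED: SKELETON row `B11.Eq132` (= displays (132)–(136)
pp. 298; HOME `run/shared/lean/pub/lit-balaban/lit-balaban-r08/ROWS-B11.md`), its members **(134)** and **(135)** — so far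
«absent: lattice formula (135) and the bound chain via [5] (3.49), (3.69), (3.137) need B9 carriers» (cell row G-B11-E4R;
(131)–(133) of the same row are `B11Eq131Projection`, abstract weak form) — and the «regularity condition (14) for the
configuration U₀» clause of the sentence leading to (136).  Unit `lit-balaban-r08` (gen 5).  Sibling modules used BY NAME
(nothing re-declared): `B9Eq39Adjoint` (the lattice calculus of [5] §A pp. 390–392 on an abstract finite lattice — sites `S`,
directions `ι`, shifts `T μ : S ≃ S`, background `U : ι → S → 𝔸ˣ` of UNITS of a ring, transport `R U X = UXU⁻¹`: `covD` =
(3.3) `D_μ`, `covDstar` = (3.8) `D*_μ`, `divB` = (3.8) `D*` on bond fields, `curl` = (3.4) `D_U` on bond fields, `divP` = (3.9)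
`D*` on plaquette functions, `plaqU` = `U(∂p_{μν}(x))`, the `η`-weighted `curlη`/`divPη`), `B9Eq352ScalarFluct.siteLap` (the
covariant Laplace operator (3.23) of [5], `Δ_U = η⁻²Σ_μ D¹*_μD¹_μ`), `B9Eq3117Current.covDη` (`D^η = η⁻¹D¹`),
`B9Eq310Hermitian` (`deltaOp` = the operator `Δ = D*D_U + Δ′` of [5] (3.10); `norm_R_le`), `B9TorusCalculus` (the tori of
record `Site P j` with `torusT`, `torusT_comm`).  Here [5] = T. Bałaban, *Propagators for lattice gauge theories in a
background field*, Commun. Math. Phys. **99** (1985) 389–434 [Balaban1985BackgroundPropagators].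

THE PRINT (p. 298 [PDF 22], verbatim from the render; p. 297 for the set-up).  p. 297: «where Δ_a = Δ + DRD* + Q*aQ (the
constant a = 1).»  p. 298: «By the definition of H₀B we have QA₀ = 0, hence P₀A₀ = A₀, Δ_aA₀ = (Δ + DRD*)A₀. … The
configuration A₀ = A′₁ − H₀B satisfies similar bounds as A′₁, and we have
  (Δ + DRD*)A₀ = (D*D + DD*)A₀ + (Δ′ − DPD*)A₀,   (134)
  (D*DA₀)_μ(x) + (DD*A₀)_μ(x) = (Δ_{U₀}A₀,μ)(x)
     − Σ_{ν=1}^{d} R(U₀(x, x + ηe_μ)U₀(x + ηe_μ, x + ηe_μ − ηe_ν)) · η⁻²[R(U₀(∂p′_μν(x))) − 1]A_ν(x + ηe^ν),   (135)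
where p′_μν(x) = ⟨x + ηe_μ − ηe_ν, x + ηe_μ, x, x − ηe_ν⟩, Δ′ and P were defined in [5] by (3.10), (3.25). This way we have
expressed (Δ + DRD*)A₀ as a sum of Δ_{U₀}A₀ and a bounded operator acting on A₀. The bound for this operator follows from
the inequality (3.49) [5] for DPD*, the inequality (3.69) [5] for Δ′, and the regularity condition (14) for the configuration
U₀. This together with (133) and the discussion following it implies the bound |Δ_{U₀}A₀|_{(−3)} < O(1)C₁B₃ε₁, hence
finally the bound |Δ_{U₀}A′₁| < O(1)C₁B₃ε₁(Lʲη)⁻³ on Ω_j, j = 0, 1, …, k. (136)»  p. 299: «Above we have used the equality RD*H = 0. … To get a bound for Δ_{U₀}HB, we write  D*DHB = (D*D + DRD*)HB = (D*D + DD*)HB − DPD*HB, (140) and we use again the formula (135), and the fact that DPD* is a bounded operator. This gives the bound |Δ_{U₀}HB|_{(−3)} ≦ O(1)|B|.»  ([5] (3.25): «Rf = (I − G′Q′*(Q′G′²Q′*)⁻¹Q′G′)f»,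
i.e. R = I − P; [5] (3.10): «⟨A,ΔA⟩ = ⟨A,D*DA⟩ + ⟨A,Δ′A⟩»; [5] (3.23): «Δ^η_U = D^{η*}_U D^η_U = Σ_{μ=1}^{d} D^{η*}_{U,μ}D^η_{U,μ}»;
(14) p. 280: «U₀ ∈ 𝔘_k({Ω_j}, C₁B₃ε₁)», i.e. by (2) p. 278 «|U(∂p) − 1| < ε₀L^{−2j} = ε₀η²(Lʲη)^{−2} for p ∈ Ω_j» with
ε₀ = C₁B₃ε₁.)

READING NOTE (located, not adjudicated).  The argument of `A_ν` in the last factor of (135) is printed «x + ηe^ν»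
(superscript ν, no μ); the kernel-checked identity has `A_ν(x + ηe_μ − ηe_ν)`, the far end of the transport
`R(U₀(x, x+ηe_μ)U₀(x+ηe_μ, x+ηe_μ−ηe_ν))` printed in front of it and the first corner of the printed contour `p′_μν(x)`:
the commutator of the covariant derivatives is `([D_μ, D*_ν]f)(x) = −R(U₀(x,x+ηe_μ)U₀(x+ηe_μ,x+ηe_μ−ηe_ν))·η⁻²[R(U₀(∂p′_μν(x))) − 1]
f(x+ηe_μ−ηe_ν)` (`covD_covDstar_sub_covDstar_covD`).  A print slip confined to one index; recorded for the cell's census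
(HOME GAPS.md row G-B11-E4R), the theorems state what the kernel proves.  The `ν = μ` summand vanishes (`plaqU'_self`:
`U₀(∂p′_μμ(x)) = 1`), so «Σ_{ν=1}^{d}» and `Σ_{ν≠μ}` agree.

WHAT THIS FILE PROVES (model = the abstract finite lattice of `B9Eq39Adjoint`; `𝔸` any ring, `U₀` ARBITRARY units — no
unitarity, no smallness — and, where a plaquette must close or a double difference telescope, COMMUTING shifts
`hT : T μ (T ν x) = T ν (T μ x)`, discharged on the tori of record by `B9TorusCalculus.torusT_comm`).
* §1 the shifted plaquette variable `plaqU'` = `U₀(∂p′_μν(x))` exactly as printed (contour `⟨z, y, x, w⟩`, `z = x+e_μ−e_ν`,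
  `y = x+e_μ`, `w = x−e_ν`, with (3.5) on reversed bonds), the transport `transp` = `U₀(x,x+e_μ)U₀(x+e_μ,x+e_μ−e_ν)`, their
  algebra (`transp_mul_plaqU'`, `plaqU'_self`, `plaqU'_eq_conj`: `U₀(∂p′_μν(x)) = U₀(w,z)⁻¹·U₀(∂p_{μν}(w))·U₀(w,z)`, a
  conjugate of `B9Eq39Adjoint.plaqU` at `w = x − e_ν`).
* §2 the unit-lattice operators of (135): `vecLap` (`Δ_{U₀}` of [5] (3.23) applied to each component `A_μ` — `siteLap` BY NAME
  carries the `η⁻²`), `hodgeOp` = `D*D_U + DD*` (`divP ∘ curl + covD ∘ divB`), `curvOp` = the printed curvature operator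
  `Σ_ν R(transp)[R(U₀(∂p′)) − 1]A_ν(z)`.
* §3 the two double covariant derivatives expanded (`covD_covDstar`, `covDstar_covD`) and **their commutator**
  `covD_covDstar_sub_covDstar_covD` — the one computation behind (135).
* §4 **(135) PROVED**: `eq135` (unit lattice: `hodgeOp = vecLap − curvOp`, i.e.
  `(D*D_UA)_μ(x) + (DD*A)_μ(x) = Σ_ν(D*_νD_νA_μ)(x) − Σ_ν R(transp)[R(U₀(∂p′_μν(x))) − 1]A_ν(x+e_μ−e_ν)`), and
  **`eq135η`** = (135) WITH THE PRINTED POWERS OF `η` (`D^η = η⁻¹D¹` on every derivative; `Δ_{U₀} = siteLap` (3.23) of [5];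
  the curvature weight `η⁻²`), in a ℂ-algebra, every real `η`.
* §5 **(134) PROVED** as operator algebra (`eq134`): with `Δ = D^{η*}D^η_U + Δ′` (`B9Eq310Hermitian.deltaOp`, [5] (3.10)) and ANY
  pair of maps `R`, `P` on site functions with `R + P = I` ([5] (3.25): `R = I − P`), `(Δ + DRD*)A = (D*D + DD*)A + (Δ′ − DPD*)A`.
* §6 THE «regularity condition (14)» CLAUSE of the (136) sentence, quantitatively (normed ring; units of norm `≤ 1` with inverses
  of norm `≤ 1` — unitary matrices in the operator norm): `‖R(W)X − X‖ ≤ 2‖W − 1‖‖X‖` (`norm_R_sub_self_le`),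
  `‖U₀(∂p′_μν(x)) − 1‖ ≤ ‖U₀(∂p_{μν}(x−e_ν)) − 1‖` (`norm_plaqU'_sub_one_le`), and **`norm_curvOp_le`**: if `‖U₀(∂p) − 1‖ ≤ δ` on
  the plaquettes and `‖A_ν(y)‖ ≤ a`, then `‖(curvOp A)_μ(x)‖ ≤ 2(d − 1)·δ·a` (`d = #ι`); with (14)'s `δ = C₁B₃ε₁η²(Lʲη)⁻²` this is
  the printed «bounded operator acting on A₀» part coming from (14) (`norm_curvOp_le_eps`, the `η⁻²`-weighted form).  The parts
  of the (136) chain resting on [5] (3.49), (3.69), (3.137) and on (133) stay by reference (rows B9.Eq3.49, B9.Eq3.69, B11.Eq132).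
* §7 the tori of record: `eq135_torus`, `eq135η_torus` (`T := torusT P j`, `hT := torusT_comm`, every background).
* §8 sanity: at `U₀ ≡ 1` the curvature operator vanishes and `D*D + DD*` IS the componentwise lattice Laplacian (`curvOp_one`,
  `hodgeOp_one`) — the flat Hodge identity on 1-cochains of the cubical torus.
* §9 (v1.1) GAUGE COVARIANCE ([5] (3.28)–(3.31) mechanism, `B9Eq3117Current.gaugeTr`/`rotB`/`rotS` BY NAME): under `U₀ ↦ U₀^u`, `A ↦ R(u)A` all three
  operators of (135) rotate by `R(u(x))` — `vecLap_gaugeTr`, `hodgeOp_gaugeTr` (no commuting shifts needed), and **`curvOp_gaugeTr`** (from (135)).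
* §10 (v1.1) **(140) p. 299 PROVED** (`eq140_first`, `eq140`, `eq140_135`): «D*DHB = (D*D + DRD*)HB = (D*D + DD*)HB − DPD*HB» for a bond field `F`
  (= `HB`) with «RD*H = 0» as the hypothesis `R(D^{η*}F) = 0` and `R + P = I`; with (135): `D^{η*}D^η_{U₀}F = Δ_{U₀}F − η⁻²𝒦F − D^ηPD^{η*}F` («we use again
  the formula (135), and the fact that DPD* is a bounded operator»).

RELATED IN THE TREE, NOT DUPLICATED (searched 2026-08-21: `grep -iln weitzenb Balaban1983to89/**/*.lean`): `Beta.PlaquetteWeitzenbock`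
(pub-balaban β sub-cell) is the Weitzenböck bookkeeping AT FIRST ORDER in the background `U₀ = e^B` for quadratic FORMS under a
trace; `B11TildeG190` cites (135) in a docstring for the smallness of `Δ⁽²⁾`; `B9Eq352ScalarFluct` is the SCALAR covariant
Laplacian (3.23)/(3.50).  None states or proves the exact-background operator identity (135) or (134).

NOT PROVED HERE, NOT CLAIMED: the bounds (136), (138)–(139), the `|·|_{(−3)}` bounds after (140) (they rest on [5] (3.42), (3.49), (3.69), (3.133), (3.137) —
typed B9 rows — and on (133)); anything about `H₀`, `P₀`, `G`; the identification of the abstract `(S, T, ι)` with `T_η` beyond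
§7.  NOT summit progress.
-/

noncomputable section

open Complex

namespace Literature.MathematicalPhysics.QuantumFieldTheory.Balaban1983to89.B11Eq135Weitzenbock

open Literature.MathematicalPhysics.QuantumFieldTheory.Balaban1983to89
open Literature.MathematicalPhysics.QuantumFieldTheory.Balaban1983to89.B9Eq39Adjoint
open Literature.MathematicalPhysics.QuantumFieldTheory.Balaban1983to89.B9Eq352ScalarFluct (siteLap)
open Literature.MathematicalPhysics.QuantumFieldTheory.Balaban1983to89.B9Eq3117Current (covDη covDη_apply)

/-! ## §1  Commuting shifts; the shifted plaquette `p′_μν(x)` and the transport of (135) -/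

section Geometry

variable {𝔸 : Type*} [Ring 𝔸] {S : Type*} {ι : Type*}
variable (T : ι → Equiv.Perm S) (U : ι → S → 𝔸ˣ)

/-- On a lattice with commuting shifts, `(x − e_ν) + e_μ = (x + e_μ) − e_ν`: the corner `z = x + e_μ − e_ν` of the printed
contour `p′_μν(x)` is reached from `w = x − e_ν` along the bond `⟨w, w + e_μ⟩`. [folklore]
[cite: Balaban1985Variational, (135) p.298] -/
theorem shift_symm_comm (hT : ∀ μ ν x, T μ (T ν x) = T ν (T μ x)) (μ ν : ι) (x : S) :
    T μ ((T ν).symm x) = (T ν).symm (T μ x) := by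
  apply (T ν).injective
  rw [Equiv.apply_symm_apply, ← hT, Equiv.apply_symm_apply]

/-- **`U₀(∂p′_μν(x))`** for the printed contour `p′_μν(x) = ⟨x + ηe_μ − ηe_ν, x + ηe_μ, x, x − ηe_ν⟩` = `⟨z, y, x, w⟩`:
`U₀(∂p′) = U₀(z,y)U₀(y,x)U₀(x,w)U₀(w,z)` with `U₀(z,y) = U₀,ν(z)`, `U₀(y,x) = U₀,μ(x)⁻¹`, `U₀(x,w) = U₀,ν(w)⁻¹` ((3.5) of [5]),
`U₀(w,z) = U₀,μ(w)` (`z = w + e_μ` on commuting shifts, `shift_symm_comm`); `z = (T ν)⁻¹(T μ x)`, `w = (T ν)⁻¹ x`.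
[cite: Balaban1985Variational, (135) p.298] -/
def plaqU' (μ ν : ι) (x : S) : 𝔸ˣ :=
  U ν ((T ν).symm (T μ x)) * (U μ x)⁻¹ * (U ν ((T ν).symm x))⁻¹ * U μ ((T ν).symm x)

/-- **The transport `U₀(x, x + ηe_μ)U₀(x + ηe_μ, x + ηe_μ − ηe_ν)`** printed in front of the bracket in (135): from the corner
`z = x + e_μ − e_ν` to `x` through `y = x + e_μ` (`U₀(y, z)⁻¹ = U₀(z, y) = U₀,ν(z)` by (3.5) of [5]).
[cite: Balaban1985Variational, (135) p.298] -/
def transp (μ ν : ι) (x : S) : 𝔸ˣ := U μ x * (U ν ((T ν).symm (T μ x)))⁻¹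

/-- Unfolding `plaqU'`. [cite: Balaban1985Variational, (135) p.298] -/
theorem plaqU'_def (μ ν : ι) (x : S) :
    plaqU' T U μ ν x = U ν ((T ν).symm (T μ x)) * (U μ x)⁻¹ * (U ν ((T ν).symm x))⁻¹ * U μ ((T ν).symm x) := rfl

/-- Unfolding `transp`. [cite: Balaban1985Variational, (135) p.298] -/
theorem transp_def (μ ν : ι) (x : S) : transp T U μ ν x = U μ x * (U ν ((T ν).symm (T μ x)))⁻¹ := rfl

/-- The transport followed by the holonomy of `p′` is the transport from `z` to `x` THE OTHER WAY round the plaquette, through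
`w = x − e_ν`: `transp · U₀(∂p′) = U₀(x, w)U₀(w, z) = U₀,ν(w)⁻¹U₀,μ(w)`. [cite: Balaban1985Variational, (135) p.298] -/
theorem transp_mul_plaqU' (μ ν : ι) (x : S) :
    transp T U μ ν x * plaqU' T U μ ν x = (U ν ((T ν).symm x))⁻¹ * U μ ((T ν).symm x) := by
  simp only [transp, plaqU', ← mul_assoc, inv_mul_cancel_right, mul_inv_cancel, one_mul]

/-- The degenerate contour `p′_μμ(x) = ⟨x, x + e_μ, x, x − e_μ⟩` has trivial holonomy: `U₀(∂p′_μμ(x)) = 1` — the `ν = μ` summand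
of (135) vanishes. [cite: Balaban1985Variational, (135) p.298] -/
theorem plaqU'_self (μ : ι) (x : S) : plaqU' T U μ μ x = 1 := by
  simp only [plaqU', Equiv.symm_apply_apply, mul_inv_cancel, one_mul, inv_mul_cancel]

/-- `p′_μν(x)` IS the plaquette `p_{μν}(w)` of [5] (3.1) based at `w = x − e_ν`, its contour read from the corner `z = w + e_μ`:
`U₀(∂p′_μν(x)) = U₀,μ(w)⁻¹ · U₀(∂p_{μν}(w)) · U₀,μ(w)` with `B9Eq39Adjoint.plaqU` (commuting shifts).
[cite: Balaban1985Variational, (135) p.298] -/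
theorem plaqU'_eq_conj (hT : ∀ μ ν x, T μ (T ν x) = T ν (T μ x)) (μ ν : ι) (x : S) :
    plaqU' T U μ ν x = (U μ ((T ν).symm x))⁻¹ * plaqU T U μ ν ((T ν).symm x) * U μ ((T ν).symm x) := by
  rw [plaqU, shift_symm_comm T hT μ ν x, Equiv.apply_symm_apply, plaqU']
  simp only [← mul_assoc, inv_mul_cancel, one_mul]

end Geometry

/-! ## §2  The operators of (135) on the unit lattice: `Δ_{U₀}` componentwise, `D*D + DD*`, and the curvature operator -/

section Operators

variable {𝔸 : Type*} [Ring 𝔸] {S : Type*} {ι : Type*} [Fintype ι]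
variable (T : ι → Equiv.Perm S) (U : ι → S → 𝔸ˣ)

/-- **`Δ_{U₀}` on bond fields, componentwise, unit lattice**: `(Δ¹_{U₀}A)_μ(x) = Σ_ν (D¹*_ν D¹_ν A_μ)(x)` — the covariant Laplace
operator `Δ_U = D*_UD_U = Σ_μ D*_{U,μ}D_{U,μ}` of [5] (3.23) applied to the site function `x ↦ A_μ(x) = A(x, x+e_μ)` (transport
of `A_μ(x ± e_ν)` to `x` along `⟨x, x ± e_ν⟩`); with its `η⁻²` it is `B9Eq352ScalarFluct.siteLap` of each component
(`siteLap_eq_vecLap`). [cite: Balaban1985Variational, (135) p.298] -/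
def vecLap (A : ι → S → 𝔸) (μ : ι) (x : S) : 𝔸 := ∑ ν, covDstar T U ν (covD T U ν (A μ)) x

/-- **The curvature operator of (135)**, unit lattice: `(𝒦A)_μ(x) = Σ_ν R(U₀(x,x+e_μ)U₀(x+e_μ,x+e_μ−e_ν))·[R(U₀(∂p′_μν(x))) − 1]
A_ν(x+e_μ−e_ν)` (the printed `η⁻²` is restored in `eq135η`). [cite: Balaban1985Variational, (135) p.298] -/
def curvOp (A : ι → S → 𝔸) (μ : ι) (x : S) : 𝔸 :=
  ∑ ν, R (transp T U μ ν x) (R (plaqU' T U μ ν x) (A ν ((T ν).symm (T μ x))) - A ν ((T ν).symm (T μ x)))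

variable [LinearOrder ι]

/-- **`D*D + DD*` on bond fields, unit lattice**: `(D¹*D¹_UA)_μ(x) + (D¹D¹*A)_μ(x)` with `D*D_U = divP ∘ curl` ([5] (3.9) applied to
(3.4)) and `DD* = covD ∘ divB` ((3.3) applied to (3.8)). [cite: Balaban1985Variational, (135) p.298] -/
def hodgeOp (A : ι → S → 𝔸) (μ : ι) (x : S) : 𝔸 :=
  divP T U (curl T U A) μ x + covD T U μ (divB T U A) x

omit [LinearOrder ι] in
/-- Unfolding `vecLap`. [cite: Balaban1985Variational, (135) p.298] -/
theorem vecLap_def (A : ι → S → 𝔸) (μ : ι) (x : S) :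
    vecLap T U A μ x = ∑ ν, covDstar T U ν (covD T U ν (A μ)) x := rfl

omit [LinearOrder ι] in
/-- Unfolding `curvOp`. [cite: Balaban1985Variational, (135) p.298] -/
theorem curvOp_def (A : ι → S → 𝔸) (μ : ι) (x : S) :
    curvOp T U A μ x
      = ∑ ν, R (transp T U μ ν x) (R (plaqU' T U μ ν x) (A ν ((T ν).symm (T μ x))) - A ν ((T ν).symm (T μ x))) := rfl

/-- Unfolding `hodgeOp`. [cite: Balaban1985Variational, (135) p.298] -/
theorem hodgeOp_def (A : ι → S → 𝔸) (μ : ι) (x : S) :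
    hodgeOp T U A μ x = divP T U (curl T U A) μ x + covD T U μ (divB T U A) x := rfl

omit [Fintype ι] [LinearOrder ι] in
/-- The `ν = μ` summand of the curvature operator vanishes (`U₀(∂p′_μμ(x)) = 1`), so the printed `Σ_{ν=1}^{d}` equals `Σ_{ν ≠ μ}`.
[cite: Balaban1985Variational, (135) p.298] -/
theorem curvOp_summand_self (A : ι → S → 𝔸) (μ : ι) (x : S) :
    R (transp T U μ μ x) (R (plaqU' T U μ μ x) (A μ ((T μ).symm (T μ x))) - A μ ((T μ).symm (T μ x))) = 0 := by
  rw [plaqU'_self, R_one, sub_self, R_zero]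

end Operators

/-! ## §3  The two double covariant derivatives and their commutator — the computation behind (135) -/

section Commutator

variable {𝔸 : Type*} [Ring 𝔸] {S : Type*} {ι : Type*}
variable (T : ι → Equiv.Perm S) (U : ι → S → 𝔸ˣ)

/-- `R` distributes over finite sums. [folklore] [cite: Balaban1985BackgroundPropagators, p.390] -/
theorem R_finset_sum {β : Type*} (s : Finset β) (W : 𝔸ˣ) (X : β → 𝔸) :
    R W (∑ i ∈ s, X i) = ∑ i ∈ s, R W (X i) := by
  simp only [R_def, Finset.mul_sum, Finset.sum_mul]

/-- `D_μ` (3.3) is additive over finite families of site functions. [folklore] [cite: Balaban1985BackgroundPropagators, (3.3) p.390] -/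
theorem covD_finset_sum {β : Type*} (s : Finset β) (μ : ι) (g : β → S → 𝔸) (x : S) :
    covD T U μ (fun y => ∑ i ∈ s, g i y) x = ∑ i ∈ s, covD T U μ (g i) x := by
  simp only [covD, R_finset_sum, Finset.sum_sub_distrib]

/-- `D_μD*_ν f` EXPANDED (four transported values of `f`; no commutation of shifts needed):
`(D_μD*_νf)(x) = R(U_μ(x)U_ν(z)⁻¹)f(z) − R(U_μ(x))f(x+e_μ) − R(U_ν(w))⁻¹f(w) + f(x)`, `z = (x+e_μ)−e_ν`, `w = x−e_ν`. [folklore]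
[cite: Balaban1985Variational, (135) p.298] -/
theorem covD_covDstar (μ ν : ι) (f : S → 𝔸) (x : S) :
    covD T U μ (covDstar T U ν f) x
      = R (U μ x * (U ν ((T ν).symm (T μ x)))⁻¹) (f ((T ν).symm (T μ x))) - R (U μ x) (f (T μ x))
        - R (U ν ((T ν).symm x))⁻¹ (f ((T ν).symm x)) + f x := by
  simp only [covD, covDstar, R_sub, B9Eq39Adjoint.R_mul]
  abel

/-- `D*_νD_μ f` EXPANDED on commuting shifts (`(x−e_ν)+e_μ = z`):
`(D*_νD_μf)(x) = R(U_ν(w)⁻¹U_μ(w))f(z) − R(U_ν(w))⁻¹f(w) − R(U_μ(x))f(x+e_μ) + f(x)`. [folklore]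
[cite: Balaban1985Variational, (135) p.298] -/
theorem covDstar_covD (hT : ∀ μ ν x, T μ (T ν x) = T ν (T μ x)) (μ ν : ι) (f : S → 𝔸) (x : S) :
    covDstar T U ν (covD T U μ f) x
      = R ((U ν ((T ν).symm x))⁻¹ * U μ ((T ν).symm x)) (f ((T ν).symm (T μ x)))
        - R (U ν ((T ν).symm x))⁻¹ (f ((T ν).symm x)) - R (U μ x) (f (T μ x)) + f x := by
  simp only [covD, covDstar, R_sub, B9Eq39Adjoint.R_mul, shift_symm_comm T hT μ ν x]
  abel

/-- **THE COMMUTATOR OF THE COVARIANT DERIVATIVES IS THE CURVATURE** (the computation behind (135)): on commuting shifts,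
`(D_μD*_νf)(x) − (D*_νD_μf)(x) = −R(U₀(x,x+e_μ)U₀(x+e_μ,x+e_μ−e_ν))·[R(U₀(∂p′_μν(x))) − 1]f(x+e_μ−e_ν)` — the three values of `f`
at `x`, `x+e_μ`, `x−e_ν` cancel and the value at the far corner `z` is transported to `x` along the two halves of `∂p′_μν(x)`.
[cite: Balaban1985Variational, (135) p.298] -/
theorem covD_covDstar_sub_covDstar_covD (hT : ∀ μ ν x, T μ (T ν x) = T ν (T μ x)) (μ ν : ι) (f : S → 𝔸) (x : S) :
    covD T U μ (covDstar T U ν f) x - covDstar T U ν (covD T U μ f) x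
      = -(R (transp T U μ ν x)
            (R (plaqU' T U μ ν x) (f ((T ν).symm (T μ x))) - f ((T ν).symm (T μ x)))) := by
  rw [R_sub, ← B9Eq39Adjoint.R_mul, transp_mul_plaqU', covD_covDstar, covDstar_covD T U hT, transp_def]
  abel

end Commutator

/-! ## §4  (135): `D*D + DD* = Δ_{U₀} − 𝒦`, unit lattice and with the printed powers of `η` -/

section Eq135

variable {𝔸 : Type*} [Ring 𝔸] {S : Type*} {ι : Type*} [Fintype ι] [LinearOrder ι]
variable (T : ι → Equiv.Perm S) (U : ι → S → 𝔸ˣ)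

/-- `D*D_U` component form: `(D*D_UA)_μ(x) = Σ_ν[(D*_νD_νA_μ)(x) − (D*_νD_μA_ν)(x)]` ((3.9) last form on the curl (3.4)). [folklore]
[cite: Balaban1985BackgroundPropagators, (3.9) p.392] -/
theorem divP_curl_eq_sum_sub (A : ι → S → 𝔸) (μ : ι) (x : S) :
    divP T U (curl T U A) μ x
      = ∑ ν, (covDstar T U ν (covD T U ν (A μ)) x - covDstar T U ν (covD T U μ (A ν)) x) := by
  rw [divP_curl]
  refine Finset.sum_congr rfl fun ν _ => ?_
  exact covDstar_sub T U ν (covD T U ν (A μ)) (covD T U μ (A ν)) x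

omit [LinearOrder ι] in
/-- `DD*` component form: `(DD*A)_μ(x) = Σ_ν (D_μD*_νA_ν)(x)` ((3.3) on (3.8)). [folklore]
[cite: Balaban1985BackgroundPropagators, (3.8) p.392] -/
theorem covD_divB_eq_sum (A : ι → S → 𝔸) (μ : ι) (x : S) :
    covD T U μ (divB T U A) x = ∑ ν, covD T U μ (covDstar T U ν (A ν)) x := by
  have hd : divB T U A = fun y => ∑ ν ∈ Finset.univ, covDstar T U ν (A ν) y := rfl
  rw [hd, covD_finset_sum]

/-- **(135), UNIT LATTICE** («(D*DA₀)_μ(x) + (DD*A₀)_μ(x) = (Δ_{U₀}A₀,μ)(x) − Σ_ν R(U₀(x,x+ηe_μ)U₀(x+ηe_μ,x+ηe_μ−ηe_ν))·η⁻²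
[R(U₀(∂p′_μν(x))) − 1]A_ν(…)», η = 1): for EVERY bond field `A` with values in any ring, every background `U₀` of units and
commuting shifts, `hodgeOp A = vecLap A − curvOp A` bondwise. [cite: Balaban1985Variational, (135) p.298] -/
theorem eq135 (hT : ∀ μ ν x, T μ (T ν x) = T ν (T μ x)) (A : ι → S → 𝔸) (μ : ι) (x : S) :
    hodgeOp T U A μ x = vecLap T U A μ x - curvOp T U A μ x := by
  rw [hodgeOp, divP_curl_eq_sum_sub, covD_divB_eq_sum, vecLap, curvOp, Finset.sum_sub_distrib, sub_add]
  congr 1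
  rw [← Finset.sum_sub_distrib]
  refine Finset.sum_congr rfl fun ν _ => ?_
  exact (neg_sub _ _).symm.trans
    ((congrArg Neg.neg (covD_covDstar_sub_covDstar_covD T U hT μ ν (A ν) x)).trans (neg_neg _))

/-- (135) unit lattice, written out with the `B9Eq39Adjoint` operators:
`(D*D_UA)_μ(x) + (D_μ D*A)(x) = Σ_ν (D*_νD_νA_μ)(x) − Σ_ν R(transp)[R(U₀(∂p′_μν(x)))A_ν(z) − A_ν(z)]`, `z = x+e_μ−e_ν`.
[cite: Balaban1985Variational, (135) p.298] -/
theorem eq135_explicit (hT : ∀ μ ν x, T μ (T ν x) = T ν (T μ x)) (A : ι → S → 𝔸) (μ : ι) (x : S) :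
    divP T U (curl T U A) μ x + covD T U μ (divB T U A) x
      = (∑ ν, covDstar T U ν (covD T U ν (A μ)) x)
        - ∑ ν, R (transp T U μ ν x)
            (R (plaqU' T U μ ν x) (A ν ((T ν).symm (T μ x))) - A ν ((T ν).symm (T μ x))) :=
  eq135 T U hT A μ x

end Eq135

section Eq135Eta

variable {𝔸 : Type*} [Ring 𝔸] [Algebra ℂ 𝔸] {S : Type*} {ι : Type*} [Fintype ι] [LinearOrder ι]
variable (T : ι → Equiv.Perm S) (U : ι → S → 𝔸ˣ)

omit [LinearOrder ι] in
/-- `Δ_{U₀}` of [5] (3.23) on a component IS `siteLap` BY NAME: `(Δ^η_{U₀}A_μ)(x) = η⁻²(Δ¹_{U₀}A)_μ(x)`.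
[cite: Balaban1985Variational, (135) p.298] -/
theorem siteLap_eq_vecLap (η : ℝ) (A : ι → S → 𝔸) (μ : ι) (x : S) :
    siteLap T U η (A μ) x = (((η : ℂ)⁻¹) ^ 2) • vecLap T U A μ x := rfl

/-- **(135) WITH THE PRINTED POWERS OF `η`**: with `D^η = η⁻¹D¹` on every derivative ([5] (3.3), (3.4), (3.8), (3.9):
`covDη`, `curlη`, `divPη`, `η⁻¹·divB`) and `Δ_{U₀} = Σ_μ D^{η*}_μD^η_μ` = `siteLap` ([5] (3.23)) on each component,
`(D^{η*}D^η_{U₀}A)_μ(x) + (D^ηD^{η*}A)_μ(x) = (Δ_{U₀}A_μ)(x) − Σ_ν R(U₀(x,x+ηe_μ)U₀(x+ηe_μ,x+ηe_μ−ηe_ν))·η⁻²[R(U₀(∂p′_μν(x))) − 1]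
A_ν(x+ηe_μ−ηe_ν)` — every real `η`, every background of units, commuting shifts. [cite: Balaban1985Variational, (135) p.298] -/
theorem eq135η (hT : ∀ μ ν x, T μ (T ν x) = T ν (T μ x)) (η : ℝ) (A : ι → S → 𝔸) (μ : ι) (x : S) :
    divPη T U η (curlη T U η A) μ x + covDη T U η (fun y => ((η : ℂ)⁻¹) • divB T U A y) μ x
      = siteLap T U η (A μ) x
        - (((η : ℂ)⁻¹) ^ 2) • ∑ ν, R (transp T U μ ν x)
            (R (plaqU' T U μ ν x) (A ν ((T ν).symm (T μ x))) - A ν ((T ν).symm (T μ x))) := by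
  have hcurl : curlη T U η A = ((η : ℂ)⁻¹) • curl T U A := by
    funext κ ν y; rfl
  have hdiv : (fun y => ((η : ℂ)⁻¹) • divB T U A y) = ((η : ℂ)⁻¹) • divB T U A := rfl
  rw [divPη, hcurl, divP_smul, covDη_apply, hdiv, covD_smul, smul_smul, smul_smul, ← smul_add, ← pow_two,
    siteLap_eq_vecLap, ← curvOp_def, ← smul_sub, ← hodgeOp_def, eq135 T U hT]

end Eq135Eta

/-! ## §5  (134): `(Δ + DRD*)A = (D*D + DD*)A + (Δ′ − DPD*)A` for `Δ = D*D_U + Δ′` and `R = I − P` -/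

section Eq134

variable {𝔸 : Type*} [Ring 𝔸] [Algebra ℂ 𝔸] {S : Type*} {ι : Type*} [Fintype ι] [LinearOrder ι]
variable (T : ι → Equiv.Perm S) (U : ι → S → 𝔸ˣ)

/-- **(134) PROVED** as operator algebra: with the operator `Δ = D^{η*}D^η_U + Δ′` of [5] (3.10) (`B9Eq310Hermitian.deltaOp`), the
site divergence `D^{η*} = η⁻¹D¹*` ((3.8)), the gradient `D^η` ((3.3)) and ANY two maps `R`, `P` of site functions with `R + P = I`
(the gauge-fixing projection `R` of [5] (3.20)–(3.21) and `P := I − R`, i.e. (3.25) «Rf = (I − G′Q′*(Q′G′²Q′*)⁻¹Q′G′)f»):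
`((Δ + DRD*)A)_μ(x) = ((D*D + DD*)A)_μ(x) + ((Δ′ − DPD*)A)_μ(x)` — every bond field `A`, every background, every `η`.
[cite: Balaban1985Variational, (134) p.298] -/
theorem eq134 (η : ℝ) (Rop Pop : (S → 𝔸) → (S → 𝔸)) (hRP : ∀ f : S → 𝔸, Rop f + Pop f = f)
    (A : ι → S → 𝔸) (μ : ι) (x : S) :
    B9Eq310Hermitian.deltaOp T U η A μ x
        + covDη T U η (Rop (fun y => ((η : ℂ)⁻¹) • divB T U A y)) μ x
      = (divPη T U η (curlη T U η A) μ x + covDη T U η (fun y => ((η : ℂ)⁻¹) • divB T U A y) μ x)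
        + (B9Eq310Hermitian.deltaPrimeOp T U η A μ x
            - covDη T U η (Pop (fun y => ((η : ℂ)⁻¹) • divB T U A y)) μ x) := by
  set g : S → 𝔸 := fun y => ((η : ℂ)⁻¹) • divB T U A y with hg
  have hR : Rop g = g - Pop g := eq_sub_of_add_eq (hRP g)
  rw [B9Eq310Hermitian.deltaOp, hR, covDη_apply, covDη_apply, covDη_apply, covD_sub, smul_sub]
  abel

/-- (134) combined with (135): `((Δ + DRD*)A)_μ(x) = (Δ_{U₀}A_μ)(x) − η⁻²(𝒦A)_μ(x) + ((Δ′ − DPD*)A)_μ(x)` — «This way we have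
expressed (Δ + DRD*)A₀ as a sum of Δ_{U₀}A₀ and a bounded operator acting on A₀» (the operator being `−η⁻²𝒦 + Δ′ − DPD*`).
[cite: Balaban1985Variational, (134)–(135) p.298] -/
theorem eq134_135 (hT : ∀ μ ν x, T μ (T ν x) = T ν (T μ x)) (η : ℝ) (Rop Pop : (S → 𝔸) → (S → 𝔸))
    (hRP : ∀ f : S → 𝔸, Rop f + Pop f = f) (A : ι → S → 𝔸) (μ : ι) (x : S) :
    B9Eq310Hermitian.deltaOp T U η A μ x
        + covDη T U η (Rop (fun y => ((η : ℂ)⁻¹) • divB T U A y)) μ x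
      = siteLap T U η (A μ) x - (((η : ℂ)⁻¹) ^ 2) • curvOp T U A μ x
        + (B9Eq310Hermitian.deltaPrimeOp T U η A μ x
            - covDη T U η (Pop (fun y => ((η : ℂ)⁻¹) • divB T U A y)) μ x) := by
  rw [eq134 T U η Rop Pop hRP, eq135η T U hT, curvOp_def]

end Eq134

/-! ## §6  The «regularity condition (14)» clause: the curvature operator is bounded by `2(d−1)·η⁻²sup‖U₀(∂p) − 1‖·sup‖A‖` -/

section Bound

variable {𝔸 : Type*} [NormedRing 𝔸] {S : Type*} {ι : Type*}
variable (T : ι → Equiv.Perm S) (U : ι → S → 𝔸ˣ)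

/-- `‖R(W)X − X‖ ≤ 2‖W − 1‖·‖X‖` for a unit `W` whose inverse has norm `≤ 1`: `WXW⁻¹ − X = (W − 1)XW⁻¹ + XW⁻¹(1 − W)`.
[folklore] [cite: Balaban1985Variational, (135) p.298] -/
theorem norm_R_sub_self_le {W : 𝔸ˣ} (h₂ : ‖((W⁻¹ : 𝔸ˣ) : 𝔸)‖ ≤ 1) (X : 𝔸) :
    ‖R W X - X‖ ≤ 2 * ‖(W : 𝔸) - 1‖ * ‖X‖ := by
  have e : R W X - X = ((W : 𝔸) - 1) * X * ((W⁻¹ : 𝔸ˣ) : 𝔸) + X * ((W⁻¹ : 𝔸ˣ) : 𝔸) * (1 - (W : 𝔸)) := by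
    simp only [R_def, sub_mul, mul_sub, one_mul, mul_one, mul_assoc, Units.inv_mul]
    abel
  rw [e]
  have n1 : ‖((W : 𝔸) - 1) * X * ((W⁻¹ : 𝔸ˣ) : 𝔸)‖ ≤ ‖(W : 𝔸) - 1‖ * ‖X‖ * 1 :=
    (norm_mul_le _ _).trans (mul_le_mul (norm_mul_le _ _) h₂ (norm_nonneg _)
      (mul_nonneg (norm_nonneg _) (norm_nonneg _)))
  have n2 : ‖X * ((W⁻¹ : 𝔸ˣ) : 𝔸) * (1 - (W : 𝔸))‖ ≤ ‖X‖ * 1 * ‖(W : 𝔸) - 1‖ := by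
    refine (norm_mul_le _ _).trans (mul_le_mul ((norm_mul_le _ _).trans ?_) (le_of_eq (norm_sub_rev _ _))
      (norm_nonneg _) (mul_nonneg (norm_nonneg _) zero_le_one))
    exact mul_le_mul_of_nonneg_left h₂ (norm_nonneg _)
  exact (norm_add_le_of_le n1 n2).trans (le_of_eq (by ring))

/-- The holonomy of `p′_μν(x)` is as close to `1` as the plaquette variable `U₀(∂p_{μν}(x − e_ν))` of [5] (3.1) it is conjugate to
(`plaqU'_eq_conj`), for bond variables of norm `≤ 1` with inverses of norm `≤ 1`:
`‖U₀(∂p′_μν(x)) − 1‖ ≤ ‖U₀(∂p_{μν}(x−e_ν)) − 1‖`. [cite: Balaban1985Variational, (135) p.298] -/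
theorem norm_plaqU'_sub_one_le (hT : ∀ μ ν x, T μ (T ν x) = T ν (T μ x))
    (hU1 : ∀ μ x, ‖(U μ x : 𝔸)‖ ≤ 1 ∧ ‖(((U μ x)⁻¹ : 𝔸ˣ) : 𝔸)‖ ≤ 1) (μ ν : ι) (x : S) :
    ‖(plaqU' T U μ ν x : 𝔸) - 1‖ ≤ ‖(plaqU T U μ ν ((T ν).symm x) : 𝔸) - 1‖ := by
  have e : (plaqU' T U μ ν x : 𝔸) - 1
      = (((U μ ((T ν).symm x))⁻¹ : 𝔸ˣ) : 𝔸) * ((plaqU T U μ ν ((T ν).symm x) : 𝔸) - 1)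
          * (U μ ((T ν).symm x) : 𝔸) := by
    rw [plaqU'_eq_conj T U hT, Units.val_mul, Units.val_mul, mul_sub, sub_mul, mul_one, Units.inv_mul]
  rw [e]
  calc ‖(((U μ ((T ν).symm x))⁻¹ : 𝔸ˣ) : 𝔸) * ((plaqU T U μ ν ((T ν).symm x) : 𝔸) - 1) * (U μ ((T ν).symm x) : 𝔸)‖
      ≤ ‖(((U μ ((T ν).symm x))⁻¹ : 𝔸ˣ) : 𝔸)‖ * ‖(plaqU T U μ ν ((T ν).symm x) : 𝔸) - 1‖
          * ‖(U μ ((T ν).symm x) : 𝔸)‖ :=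
        (norm_mul_le _ _).trans (mul_le_mul_of_nonneg_right (norm_mul_le _ _) (norm_nonneg _))
    _ ≤ 1 * ‖(plaqU T U μ ν ((T ν).symm x) : 𝔸) - 1‖ * 1 :=
        mul_le_mul (mul_le_mul_of_nonneg_right (hU1 μ _).2 (norm_nonneg _)) (hU1 μ _).1 (norm_nonneg _)
          (by positivity)
    _ = ‖(plaqU T U μ ν ((T ν).symm x) : 𝔸) - 1‖ := by ring

/-- Two factors of norm `≤ 1` have a product of norm `≤ 1`. [folklore] [cite: Balaban1985Variational, (135) p.298] -/
private theorem norm_mul_le_one_aux {p q : 𝔸} (hp : ‖p‖ ≤ 1) (hq : ‖q‖ ≤ 1) : ‖p * q‖ ≤ 1 :=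
  (norm_mul_le _ _).trans (by nlinarith [norm_nonneg p, norm_nonneg q])

/-- ONE SUMMAND of the curvature operator: `‖R(transp)[R(U₀(∂p′_μν(x))) − 1]A_ν(z)‖ ≤ 2·‖U₀(∂p_{μν}(x−e_ν)) − 1‖·‖A_ν(z)‖`.
[cite: Balaban1985Variational, (135) p.298] -/
theorem norm_curvOp_summand_le (hT : ∀ μ ν x, T μ (T ν x) = T ν (T μ x))
    (hU1 : ∀ μ x, ‖(U μ x : 𝔸)‖ ≤ 1 ∧ ‖(((U μ x)⁻¹ : 𝔸ˣ) : 𝔸)‖ ≤ 1) (A : ι → S → 𝔸) (μ ν : ι) (x : S) :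
    ‖R (transp T U μ ν x)
        (R (plaqU' T U μ ν x) (A ν ((T ν).symm (T μ x))) - A ν ((T ν).symm (T μ x)))‖
      ≤ 2 * ‖(plaqU T U μ ν ((T ν).symm x) : 𝔸) - 1‖ * ‖A ν ((T ν).symm (T μ x))‖ := by
  have ht1 : ‖(transp T U μ ν x : 𝔸)‖ ≤ 1 := by
    rw [transp_def, Units.val_mul]
    exact norm_mul_le_one_aux (hU1 μ x).1 (hU1 ν _).2
  have ht2 : ‖(((transp T U μ ν x)⁻¹ : 𝔸ˣ) : 𝔸)‖ ≤ 1 := by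
    rw [transp_def, mul_inv_rev, inv_inv, Units.val_mul]
    exact norm_mul_le_one_aux (hU1 ν _).1 (hU1 μ x).2
  have hp2 : ‖(((plaqU' T U μ ν x)⁻¹ : 𝔸ˣ) : 𝔸)‖ ≤ 1 := by
    rw [plaqU'_def]
    simp only [mul_inv_rev, inv_inv, Units.val_mul, ← mul_assoc]
    exact norm_mul_le_one_aux (norm_mul_le_one_aux (norm_mul_le_one_aux (hU1 μ _).2 (hU1 ν _).1)
      (hU1 μ x).1) (hU1 ν _).2
  calc ‖R (transp T U μ ν x)
          (R (plaqU' T U μ ν x) (A ν ((T ν).symm (T μ x))) - A ν ((T ν).symm (T μ x)))‖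
      ≤ ‖R (plaqU' T U μ ν x) (A ν ((T ν).symm (T μ x))) - A ν ((T ν).symm (T μ x))‖ :=
        B9Eq310Hermitian.norm_R_le ht1 ht2 _
    _ ≤ 2 * ‖(plaqU' T U μ ν x : 𝔸) - 1‖ * ‖A ν ((T ν).symm (T μ x))‖ := norm_R_sub_self_le hp2 _
    _ ≤ 2 * ‖(plaqU T U μ ν ((T ν).symm x) : 𝔸) - 1‖ * ‖A ν ((T ν).symm (T μ x))‖ :=
        mul_le_mul_of_nonneg_right
          (mul_le_mul_of_nonneg_left (norm_plaqU'_sub_one_le T U hT hU1 μ ν x) zero_le_two) (norm_nonneg _)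

variable [Fintype ι]

/-- A finite sum whose `μ`-th term vanishes and whose other terms are bounded by `C` has norm `≤ (d − 1)·C`, `d = #ι`.
[folklore] [cite: Balaban1985Variational, (135) p.298] -/
theorem norm_sum_le_of_forall_ne (F : ι → 𝔸) (μ : ι) (C : ℝ) (h0 : F μ = 0)
    (h : ∀ ν, ν ≠ μ → ‖F ν‖ ≤ C) : ‖∑ ν, F ν‖ ≤ (Fintype.card ι - 1 : ℝ) * C := by
  classical
  rw [← Finset.sum_erase Finset.univ h0]
  have hcard : ((Finset.univ.erase μ).card : ℝ) = (Fintype.card ι - 1 : ℝ) := by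
    rw [Finset.card_erase_of_mem (Finset.mem_univ μ), Finset.card_univ,
      Nat.cast_sub (Fintype.card_pos_iff.mpr ⟨μ⟩), Nat.cast_one]
  calc ‖∑ ν ∈ Finset.univ.erase μ, F ν‖ ≤ ∑ ν ∈ Finset.univ.erase μ, ‖F ν‖ := norm_sum_le _ _
    _ ≤ ∑ _ν ∈ Finset.univ.erase μ, C := Finset.sum_le_sum fun ν hν => h ν (Finset.ne_of_mem_erase hν)
    _ = (Fintype.card ι - 1 : ℝ) * C := by rw [Finset.sum_const, nsmul_eq_mul, hcard]

/-- **THE «regularity condition (14)» CLAUSE of the (136) sentence, quantitatively**: if the plaquette variables of the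
background satisfy `‖U₀(∂p_{μν}(y)) − 1‖ ≤ δ` for `μ ≠ ν` (on `Ω_j`: (14)/(2) give `δ = C₁B₃ε₁η²(Lʲη)⁻²`) and `‖A_ν(y)‖ ≤ a`, then
the curvature operator of (135) is bounded, `‖(𝒦A)_μ(x)‖ ≤ 2(d − 1)·δ·a`, `d = #ι` (the `ν = μ` summand is zero).  Units of norm
`≤ 1` with inverses of norm `≤ 1` (unitary matrices in the operator norm). [cite: Balaban1985Variational, (135)–(136) p.298] -/
theorem norm_curvOp_le (hT : ∀ μ ν x, T μ (T ν x) = T ν (T μ x))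
    (hU1 : ∀ μ x, ‖(U μ x : 𝔸)‖ ≤ 1 ∧ ‖(((U μ x)⁻¹ : 𝔸ˣ) : 𝔸)‖ ≤ 1) {δ a : ℝ}
    (hP : ∀ μ ν y, μ ≠ ν → ‖(plaqU T U μ ν y : 𝔸) - 1‖ ≤ δ) {A : ι → S → 𝔸} (hA : ∀ ν y, ‖A ν y‖ ≤ a)
    (μ : ι) (x : S) :
    ‖curvOp T U A μ x‖ ≤ 2 * (Fintype.card ι - 1 : ℝ) * δ * a := by
  have hmain := norm_sum_le_of_forall_ne
    (fun ν => R (transp T U μ ν x)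
      (R (plaqU' T U μ ν x) (A ν ((T ν).symm (T μ x))) - A ν ((T ν).symm (T μ x))))
    μ (2 * δ * a) (curvOp_summand_self T U A μ x) (fun ν hne => by
      have hPle := hP μ ν ((T ν).symm x) hne.symm
      have hδ : 0 ≤ δ := (norm_nonneg _).trans hPle
      exact (norm_curvOp_summand_le T U hT hU1 A μ ν x).trans
        (mul_le_mul (mul_le_mul_of_nonneg_left hPle zero_le_two) (hA ν _) (norm_nonneg _)
          (mul_nonneg zero_le_two hδ)))
  rw [curvOp_def]
  exact hmain.trans (le_of_eq (by ring))

end Bound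

section BoundEta

variable {𝔸 : Type*} [NormedRing 𝔸] [NormedAlgebra ℂ 𝔸] {S : Type*} {ι : Type*} [Fintype ι]
variable (T : ι → Equiv.Perm S) (U : ι → S → 𝔸ˣ)

/-- The same with the printed weights: under (14) in the form «η⁻²‖U₀(∂p) − 1‖ ≤ ε(Lʲη)⁻²» on the plaquettes concerned
(ε = C₁B₃ε₁ by (14), (2)) and `‖A_ν(y)‖ ≤ a`, the `η⁻²`-weighted curvature term of (135) is bounded by `2(d−1)·ε(Lʲη)⁻²·a`
— with `a = O(1)C₁B₃ε₁(Lʲη)⁻¹` (the bounds on `A₀`) a contribution `O(1)(C₁B₃ε₁)²(Lʲη)⁻³` to the (136) chain.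
[cite: Balaban1985Variational, (135)–(136) p.298, (14) p.280] -/
theorem norm_curvOp_le_eps (hT : ∀ μ ν x, T μ (T ν x) = T ν (T μ x))
    (hU1 : ∀ μ x, ‖(U μ x : 𝔸)‖ ≤ 1 ∧ ‖(((U μ x)⁻¹ : 𝔸ˣ) : 𝔸)‖ ≤ 1) {η ε s a : ℝ} (hη : 0 < η)
    (hP : ∀ μ ν y, μ ≠ ν → η⁻¹ ^ 2 * ‖(plaqU T U μ ν y : 𝔸) - 1‖ ≤ ε * s⁻¹ ^ 2) {A : ι → S → 𝔸}
    (hA : ∀ ν y, ‖A ν y‖ ≤ a) (μ : ι) (x : S) :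
    ‖(((η : ℂ)⁻¹) ^ 2) • curvOp T U A μ x‖ ≤ 2 * (Fintype.card ι - 1 : ℝ) * (ε * s⁻¹ ^ 2) * a := by
  have hn : ‖(((η : ℂ)⁻¹) ^ 2)‖ = η⁻¹ ^ 2 := by
    rw [norm_pow, norm_inv, Complex.norm_real, Real.norm_eq_abs, abs_of_pos hη]
  have h2 : 0 ≤ η⁻¹ ^ 2 := by positivity
  have hmain := norm_sum_le_of_forall_ne
    (fun ν => (((η : ℂ)⁻¹) ^ 2) • R (transp T U μ ν x)
      (R (plaqU' T U μ ν x) (A ν ((T ν).symm (T μ x))) - A ν ((T ν).symm (T μ x))))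
    μ (2 * (ε * s⁻¹ ^ 2) * a) (by simp only [curvOp_summand_self, smul_zero]) (fun ν hne => by
      have hPle := hP μ ν ((T ν).symm x) hne.symm
      have hAle := hA ν ((T ν).symm (T μ x))
      have hS := mul_le_mul_of_nonneg_left (norm_curvOp_summand_le T U hT hU1 A μ ν x) h2
      have hPn := norm_nonneg ((plaqU T U μ ν ((T ν).symm x) : 𝔸) - 1)
      have hAn := norm_nonneg (A ν ((T ν).symm (T μ x)))
      have hε : 0 ≤ ε * s⁻¹ ^ 2 := (mul_nonneg h2 hPn).trans hPle
      simp only [norm_smul, hn]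
      nlinarith [hS, hPle, hAle, hAn, hε, hPn])
  rw [curvOp_def, Finset.smul_sum]
  exact hmain.trans (le_of_eq (by ring))

end BoundEta

/-! ## §7  The tori of record `Site P j` (`B9TorusCalculus`): the hypothesis `hT` discharged -/

section Torus

variable {P : Params} {j : ℕ}

/-- **(135) on the torus `T^{(j)}`**, unit lattice, EVERY background of units of any ring (`torusT_comm` discharges the commuting
of the shifts). [cite: Balaban1985Variational, (135) p.298] -/
theorem eq135_torus {𝔸 : Type*} [Ring 𝔸] (U : Fin P.d → Site P j → 𝔸ˣ) (A : Fin P.d → Site P j → 𝔸)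
    (μ : Fin P.d) (x : Site P j) :
    hodgeOp (B9TorusCalculus.torusT P j) U A μ x
      = vecLap (B9TorusCalculus.torusT P j) U A μ x - curvOp (B9TorusCalculus.torusT P j) U A μ x :=
  eq135 _ U B9TorusCalculus.torusT_comm A μ x

/-- **(135) on the torus `T^{(j)}` with the printed powers of `η`.** [cite: Balaban1985Variational, (135) p.298] -/
theorem eq135η_torus {𝔸 : Type*} [Ring 𝔸] [Algebra ℂ 𝔸] (U : Fin P.d → Site P j → 𝔸ˣ) (η : ℝ)
    (A : Fin P.d → Site P j → 𝔸) (μ : Fin P.d) (x : Site P j) :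
    divPη (B9TorusCalculus.torusT P j) U η (curlη (B9TorusCalculus.torusT P j) U η A) μ x
        + covDη (B9TorusCalculus.torusT P j) U η
            (fun y => ((η : ℂ)⁻¹) • divB (B9TorusCalculus.torusT P j) U A y) μ x
      = siteLap (B9TorusCalculus.torusT P j) U η (A μ) x
        - (((η : ℂ)⁻¹) ^ 2) • ∑ ν, R (transp (B9TorusCalculus.torusT P j) U μ ν x)
            (R (plaqU' (B9TorusCalculus.torusT P j) U μ ν x)
                (A ν (((B9TorusCalculus.torusT P j) ν).symm ((B9TorusCalculus.torusT P j) μ x)))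
              - A ν (((B9TorusCalculus.torusT P j) ν).symm ((B9TorusCalculus.torusT P j) μ x))) :=
  eq135η _ U B9TorusCalculus.torusT_comm η A μ x

end Torus

/-! ## §8  Sanity: at the trivial background the curvature operator vanishes and `D*D + DD* = Δ` componentwise -/

section Flat

variable {𝔸 : Type*} [Ring 𝔸] {S : Type*} {ι : Type*} [Fintype ι] [LinearOrder ι]
variable (T : ι → Equiv.Perm S)

omit [LinearOrder ι] in
/-- At `U₀ ≡ 1` every holonomy is `1` and the curvature operator of (135) vanishes. [cite: Balaban1985Variational, (135) p.298] -/
theorem curvOp_one (A : ι → S → 𝔸) (μ : ι) (x : S) : curvOp T (fun _ _ => (1 : 𝔸ˣ)) A μ x = 0 := by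
  simp [curvOp, plaqU', transp]

/-- … so that `D*D + DD*` IS the componentwise lattice Laplacian `Σ_ν ∂*_ν∂_ν` (the flat Hodge identity on 1-cochains of the
cubical lattice; «the operator ∂*∂ in the Abelian case» of [5] p. 392 completed by `∂∂*`). [cite: Balaban1985Variational, (135) p.298] -/
theorem hodgeOp_one (hT : ∀ μ ν x, T μ (T ν x) = T ν (T μ x)) (A : ι → S → 𝔸) (μ : ι) (x : S) :
    hodgeOp T (fun _ _ => (1 : 𝔸ˣ)) A μ x = vecLap T (fun _ _ => (1 : 𝔸ˣ)) A μ x := by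
  rw [eq135 T _ hT, curvOp_one, sub_zero]

end Flat

/-! ## §9  (v1.1) Gauge covariance of the three operators of (135) ([5] (3.28)–(3.31) mechanism) -/

section Gauge

variable {𝔸 : Type*} [Ring 𝔸] {S : Type*} {ι : Type*} [Fintype ι]
variable (T : ι → Equiv.Perm S) (U : ι → S → 𝔸ˣ)

open Literature.MathematicalPhysics.QuantumFieldTheory.Balaban1983to89.B9Eq3117Current (gaugeTr rotB rotS covD_gaugeTr
  covDstar_gaugeTr curl_gaugeTr divB_gaugeTr divP_gaugeTr)

/-- `Δ_{U₀}` componentwise is gauge covariant: `Δ¹_{U₀^u}(R(u)A) = R(u)Δ¹_{U₀}A` bondwise ([5] (3.31) «Δ^η_{U^u} = R(u)Δ^η_UR(u⁻¹)», for each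
component; no commuting shifts needed). [cite: Balaban1985Variational, (135) p.298] -/
theorem vecLap_gaugeTr (u : S → 𝔸ˣ) (A : ι → S → 𝔸) (μ : ι) (x : S) :
    vecLap T (gaugeTr T u U) (rotB u A) μ x = R (u x) (vecLap T U A μ x) := by
  rw [vecLap, vecLap, R_finset_sum]
  refine Finset.sum_congr rfl fun ν _ => ?_
  have h1 : rotB u A μ = rotS u (A μ) := rfl
  have h2 : covD T (gaugeTr T u U) ν (rotS u (A μ)) = rotS u (covD T U ν (A μ)) :=
    funext fun y => covD_gaugeTr T U u ν (A μ) y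
  rw [h1, h2, covDstar_gaugeTr]

variable [LinearOrder ι]

/-- `D*D_U + DD*` is gauge covariant: `(D*D_{U₀^u} + DD*)(R(u)A) = R(u)(D*D_{U₀} + DD*)A` bondwise ((3.9) on the covariant curl and (3.3) on the
covariant divergence; no commuting shifts needed). [cite: Balaban1985Variational, (135) p.298] -/
theorem hodgeOp_gaugeTr (u : S → 𝔸ˣ) (A : ι → S → 𝔸) (μ : ι) (x : S) :
    hodgeOp T (gaugeTr T u U) (rotB u A) μ x = R (u x) (hodgeOp T U A μ x) := by
  have hc : curl T (gaugeTr T u U) (rotB u A) = fun κ ν y => R (u y) (curl T U A κ ν y) :=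
    funext fun κ => funext fun ν => funext fun y => curl_gaugeTr T U u A κ ν y
  have hd : divB T (gaugeTr T u U) (rotB u A) = rotS u (divB T U A) :=
    funext fun y => divB_gaugeTr T U u A y
  rw [hodgeOp, hodgeOp, hc, divP_gaugeTr, hd, covD_gaugeTr, R_add]

/-- **The curvature operator of (135) is gauge covariant**: `𝒦_{U₀^u}(R(u)A) = R(u)𝒦_{U₀}A` bondwise — from (135) and the covariance of
`Δ_{U₀}` and `D*D + DD*` (commuting shifts). [cite: Balaban1985Variational, (135) p.298] -/
theorem curvOp_gaugeTr (hT : ∀ μ ν x, T μ (T ν x) = T ν (T μ x)) (u : S → 𝔸ˣ) (A : ι → S → 𝔸) (μ : ι) (x : S) :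
    curvOp T (gaugeTr T u U) (rotB u A) μ x = R (u x) (curvOp T U A μ x) := by
  have h := eq135 T (gaugeTr T u U) hT (rotB u A) μ x
  rw [hodgeOp_gaugeTr, vecLap_gaugeTr, eq135 T U hT, R_sub] at h
  exact (sub_right_injective h).symm ▸ rfl

end Gauge

/-! ## §10  (v1.1) (140) p. 299: `D*DHB = (D*D + DRD*)HB = (D*D + DD*)HB − DPD*HB` under `RD*H = 0` -/

section Eq140

variable {𝔸 : Type*} [Ring 𝔸] [Algebra ℂ 𝔸] {S : Type*} {ι : Type*} [Fintype ι] [LinearOrder ι]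
variable (T : ι → Equiv.Perm S) (U : ι → S → 𝔸ˣ)

/-- **(140), FIRST EQUALITY** «D*DHB = (D*D + DRD*)HB» for a bond field `F` (= `HB`) with «RD*H = 0» in the form `R(D^{η*}F) = 0`
(`R` any map of site functions): the `DRD*` term vanishes since `D^η 0 = 0`. [cite: Balaban1985Variational, (140) p.299] -/
theorem eq140_first (η : ℝ) (Rop : (S → 𝔸) → (S → 𝔸)) (F : ι → S → 𝔸)
    (hRF : Rop (fun y => ((η : ℂ)⁻¹) • divB T U F y) = 0) (μ : ι) (x : S) :
    divPη T U η (curlη T U η F) μ x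
      = divPη T U η (curlη T U η F) μ x + covDη T U η (Rop (fun y => ((η : ℂ)⁻¹) • divB T U F y)) μ x := by
  rw [hRF, covDη_apply, covD_zero, smul_zero, add_zero]

/-- **(140) p. 299 PROVED**: «D*DHB = (D*D + DRD*)HB = (D*D + DD*)HB − DPD*HB» — for a bond field `F` (= `HB`), ANY maps `R`, `P` of site functions
with `R + P = I` ([5] (3.25)) and «RD*H = 0» as `R(D^{η*}F) = 0`: `D^{η*}D^η_{U₀}F = (D^{η*}D^η_{U₀} + D^ηD^{η*})F − D^ηPD^{η*}F` bondwise.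
[cite: Balaban1985Variational, (140) p.299] -/
theorem eq140 (η : ℝ) (Rop Pop : (S → 𝔸) → (S → 𝔸)) (hRP : ∀ f : S → 𝔸, Rop f + Pop f = f) (F : ι → S → 𝔸)
    (hRF : Rop (fun y => ((η : ℂ)⁻¹) • divB T U F y) = 0) (μ : ι) (x : S) :
    divPη T U η (curlη T U η F) μ x
      = (divPη T U η (curlη T U η F) μ x + covDη T U η (fun y => ((η : ℂ)⁻¹) • divB T U F y) μ x)
        - covDη T U η (Pop (fun y => ((η : ℂ)⁻¹) • divB T U F y)) μ x := by
  set g : S → 𝔸 := fun y => ((η : ℂ)⁻¹) • divB T U F y with hg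
  have hP : Pop g = g := by
    have h := hRP g
    rwa [hRF, zero_add] at h
  rw [hP, add_sub_cancel_right]

/-- (140) combined with (135) («we use again the formula (135), and the fact that DPD* is a bounded operator»): under the same hypotheses and
commuting shifts, `(D^{η*}D^η_{U₀}F)_μ(x) = (Δ_{U₀}F_μ)(x) − η⁻²(𝒦F)_μ(x) − (D^ηPD^{η*}F)_μ(x)` — `D*DHB` is `Δ_{U₀}HB` up to the two bounded
operators. [cite: Balaban1985Variational, (140) p.299, (135) p.298] -/
theorem eq140_135 (hT : ∀ μ ν x, T μ (T ν x) = T ν (T μ x)) (η : ℝ) (Rop Pop : (S → 𝔸) → (S → 𝔸))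
    (hRP : ∀ f : S → 𝔸, Rop f + Pop f = f) (F : ι → S → 𝔸) (hRF : Rop (fun y => ((η : ℂ)⁻¹) • divB T U F y) = 0)
    (μ : ι) (x : S) :
    divPη T U η (curlη T U η F) μ x
      = siteLap T U η (F μ) x - (((η : ℂ)⁻¹) ^ 2) • curvOp T U F μ x
        - covDη T U η (Pop (fun y => ((η : ℂ)⁻¹) • divB T U F y)) μ x := by
  rw [eq140 T U η Rop Pop hRP F hRF μ x, eq135η T U hT, curvOp_def]

end Eq140

end Literature.MathematicalPhysics.QuantumFieldTheory.Balaban1983to89.B11Eq135Weitzenbock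

end
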